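import Literature.MathematicalPhysics.QuantumLattice.InfVolFermionStateProduct
import Literature.MathematicalPhysics.QuantumLattice.GibbsFreeEnergyCouplingConcavity
import Literature.MathematicalPhysics.QuantumLattice.HubbardGaugeBound
import Literature.MathematicalPhysics.QuantumLattice.HubbardTTPrimeTorusFreeEnergyConcavity
import Literature.MathematicalPhysics.QuantumLattice.HubbardTorusTTPrimeMarkovPressureClusterBound
import Literature.MathematicalPhysics.QuantumLattice.HubbardHoppingBondNormSharp
import HarnessLib

/-!
# Decoupled legs at positive temperature: the Gibbs weight of `Σ_k Γ_k H` factorises, interleg words have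
# zero thermal expectation, and `|K| log Z(H) ≤ log Z(Σ_k Γ_k H + interleg hoppings) ≤ |K| log Z(H) + |β|‖W‖`

Topic `Literature/MathematicalPhysics/QuantumLattice` (namespace = path; family `hubbard`). The `T > 0`, FINITE-VOLUME
twin of `LayeredLatticeEnergyTransport.lean` (ground-state energy densities of layered crystals in the thermodynamic
limit): for the phase map's temperature axis the certified objects are traces on finite tori (`Matrix.partitionFn`,
`Matrix.gibbsState`, the pressure / free-energy certificates of the thermal crew), so the interlayer-coupling
bookkeeping is redone here at the level of `log Z`. Setting: a finite «layer» site type `Λ₂`, a «crystal» site type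
`Λ₃`, legs `φ_k : Λ₂ ↪ Λ₃` (`k ∈ K`) with pairwise disjoint images, a `Θ`-even layer Hamiltonian `H`, the
DECOUPLED Hamiltonian `H₀ = Σ_k Γ_{φ_k}(H)`, and interleg hoppings
`W = Σ_p −tz_p Σ_{y,σ} (c†_{φ_{k_p} y,σ} c_{φ_{j_p} y,σ} + h.c.)`.

* §1 `e^{−βH₀} = Π_k Γ_k(e^{−βH})` (`gibbsWeight_decoupledSum`: the summands are even elements of disjoint regions,
  hence commute — `Matrix.exp_sum_of_commute`, `Γ ∘ exp = exp ∘ Γ`); the tracial state factorises over the legs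
  (`normTrace_noncommProd_fermionEmbed`, product property of `InfVolFermionStateProduct.normTrace`); hence
  **`partitionFn_decoupledSum`: `Z_β(H₀) = Z_β(H)^{|K|}`** for tiling legs (`N₃ = |K| N₂` orbitals; general form
  `partitionFn_decoupledSum_eq` with the dimension factors).
* §2 **interleg words have zero weight**: `tr(Π_k Γ_k(a_k) · Γ_k(x) Γ_j(y)) = 0` for `Θ`-odd `x`, `k ≠ j`
  (`trace_noncommProd_mul_fermionEmbed_mul_fermionEmbed_eq_zero`), so `⟨Γ_k(x) Γ_j(y)⟩_{β,H₀} = 0`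
  (`gibbsState_decoupledSum_fermionEmbed_mul_fermionEmbed`).
* §3 `interlegHopping φ k j t`: Hermitian, **zero mean in the decoupled Gibbs state**
  (`gibbsState_decoupledSum_interlegHopping`), norm `≤ 4|t|·|Λ₂|` (`norm_interlegHopping_le`).
* §4 the Peierls–Bogoliubov bracket with a centred perturbation
  (`log_partitionFn_add_mem_Icc_of_gibbsState_eq_zero`: `log Z(H) ≤ log Z(H+W) ≤ log Z(H) + |β|‖W‖` when `⟨W⟩_H = 0`),
  and **`log_partitionFn_decoupledSum_add_interleg_mem_Icc`**:
  `|K| log Z(H) ≤ log Z(H₀ + Σ_p W_p) ≤ |K| log Z(H) + 4|β||Λ₂| Σ_p |tz_p|` — coupling the legs can only RAISE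
  `log Z` (lower the free energy), by at most the norm of the coupling.
* §6 (append) the SHARP rung norm `‖interleg hopping‖ ≤ 2|t||Λ₂|` (`norm_interlegHopping_le_two_mul`, Koma–Tasaki's
  two-spin bond norm `norm_hoppingTerm_le_two_mul`) and the sharpened bounds `…_mem_Icc_sharp` (allowance
  `2|β||Λ₂|Σ|tz|`; per site `2Σ_p|tz_p|/L` — the same constant as at `T = 0`).
* §5 the layered `t–t'` Hubbard torus `(ℤ/Lℤ)³` from `L` copies of `H^{tt'}_L − μN_L` on `(ℤ/Lℤ)²`
  (`torusLayerLeg`, `decoupledHubbardTorus`, `torusInterlayerHopping`, `layeredHubbardTorus`):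
  **`log_partitionFn_layeredHubbardTorus_mem_Icc`** (`L log Z₂ ≤ log Z₃ ≤ L log Z₂ + 4|β|L² Σ_p|tz_p|`, every `β`,
  `L`, pattern) and the per-site grand potential form `grandPotentialPerSite_layeredHubbardTorus_mem_Icc`
  (`∈ [f₂ − 4Σ_p|tz_p|/L, f₂]`; uniform vertical stacking `Σ_p |tz_p| = L|t_z|`: allowance `4|t_z|` per site).

Everything is PROVED; definitions with bodies: `legOrbs`, `decoupledSum`, `interlegHopping`, `torusLayerLeg`,
`decoupledHubbardTorus`, `torusInterlayerHopping`, `layeredHubbardTorus`; no named fact, no number. HONEST SCOPE: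
finite volume, every `L` (no thermodynamic limit taken here); grand-canonical layers (a canonical sector of the whole
crystal does not factorise over layers); the interleg constant is the crude `4|t|` per rung pair of words (`2|t|` would
need the two-site hopping norm); nothing here bears on order or a phase word. Implementation note: at the concrete torus
types two `DecidableEq` instance paths coexist (cf. `InfVolFermionState.lean`), so the torus Hamiltonian is assembled
from two separately elaborated summands and the final transfer uses `convert` (instance arguments are subsingletons).

## Tree / Mathlib search

REUSED: `normTrace` (+ `_mul_of_mem_carSubalgebra`, `_fermionEmbed`, `_one`) (`InfVolFermionStateProduct`);
`fermionEmbed` + `_mem_carSubalgebra/EvenSubalgebra`, `_creation/_annihilation/_conjTranspose`, `jwEmbed_exp`,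
`relabel_exp`; `JordanWigner.mem_carEvenSubalgebra_univ_of_parityAut_eq`, `commute_of_mem_carEvenSubalgebra`,
`trace_mul_eq_zero_of_odd_of_even`; `Matrix.partitionFn/gibbsWeight/gibbsState`, `partitionFn_eq_re`,
`log_partitionFn_sub_mem_Icc` (`GibbsFreeEnergyCouplingConcavity`), `abs_re_gibbsState_le`
(`ApproximatingHamiltonianProofs`), `norm_creation_le_one`/`norm_annihilation_le_one` (`HubbardGaugeBound`),
`hubbardTorusTT'`, `isHermitian_hubbardTorusTT'_sub_mu`, `parityAut_hubbardTorusTT'_sub_mu`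
(`HubbardTorusTTPrimeMarkovPressureClusterBound`); Mathlib `Matrix.exp_sum_of_commute`, `NormedSpace.map_exp`,
`Finset.noncommProd` (+ `mul_noncommProd_erase`, `noncommProd_induction`), `Fin.consEquiv`-style `Fin.cons` legs.
`lean search 'decoupled|interlayer.*partitionFn|layered.*Torus'`: nothing.

## References

* E. H. Lieb, CMP 31 (1973) 327, §V eqs. (5.2)–(5.4) (Peierls–Bogoliubov / Bogoliubov inequalities, the bracket
  `⟨W⟩_{H+W} ≤ F(H+W) − F(H) ≤ ⟨W⟩_H`). [cite: Lieb1973, §V eqs. (5.2)–(5.4)]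
* H. Araki, H. Moriya, Rev. Math. Phys. 15 (2003) 93, §4.1 (tracial state, product property (4.16), even elements,
  (4.8)), §11.1 (products over disjoint regions). [cite: ArakiMoriya2003, §4.1 eq. (4.16)]
* O. Bratteli, D. W. Robinson, *OAQSM 2* (1997), §5.2.2 (CAR algebra, graded commutation, trace state);
  *OAQSM 1* (1987), Prop. 2.3.11. [cite: BratteliRobinsonII1997, §5.2.2]
* E. Pavarini et al., PRL 87 (2001) 047003, eq. (1) (interlayer hoppings of layered cuprates). [cite: PavariniEtAl2001, eq. (1)]
-/

noncomputable section

namespace Literature.MathematicalPhysics.QuantumLattice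

open Matrix Finset HubbardWave0
open scoped ComplexOrder BigOperators Matrix.Norms.L2Operator

/-! ### §1. Legs, decoupled Hamiltonians, and the factorisation of the Gibbs weight -/

section Decoupled

variable {Λ₂ Λ₃ : Type*} [LinearOrder Λ₂] [Fintype Λ₂] [LinearOrder Λ₃] [Fintype Λ₃]
  {K : Type*} [Fintype K] [DecidableEq K]

/-- `Θ` commutes with the matrix exponential (`Θ` is a continuous algebra homomorphism).
[cite: ArakiMoriya2003, §4.1 Def. 4.2] -/
theorem parityAut_exp {κ : Type*} [LinearOrder κ] [Fintype κ] (X : Matrix (Finset κ) (Finset κ) ℂ) :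
    parityAut (NormedSpace.exp X) = NormedSpace.exp (parityAut X) :=
  open scoped Matrix.Norms.Operator in
    NormedSpace.map_exp (parityAut (κ := κ)) (parityAut (κ := κ)).toLinearMap.continuous_of_finiteDimensional X

/-- `Γ(φ)` commutes with the matrix exponential. [cite: BratteliRobinsonII1997, §5.2.2] -/
theorem fermionEmbed_exp (ψ : Λ₂ ↪ Λ₃) (X : Matrix (Finset (Orb Λ₂)) (Finset (Orb Λ₂)) ℂ) :
    fermionEmbed ψ (NormedSpace.exp X) = NormedSpace.exp (fermionEmbed ψ X) := by
  rw [fermionEmbed_apply, fermionEmbed_apply, relabel_exp, jwEmbed_exp]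

/-- The Gibbs weight `e^{-βH}` of a `Θ`-even Hamiltonian is `Θ`-even. [cite: ArakiMoriya2003, §4.1] -/
theorem parityAut_gibbsWeight {κ : Type*} [LinearOrder κ] [Fintype κ] {H : Matrix (Finset κ) (Finset κ) ℂ}
    (hH : parityAut H = H) (β : ℝ) : parityAut (Matrix.gibbsWeight β H) = Matrix.gibbsWeight β H := by
  rw [Matrix.gibbsWeight, parityAut_exp, map_smul, hH]

variable (φ : K → (Λ₂ ↪ Λ₃))

/-- **The orbitals of the `k`-th leg** (over the image sites of `φ k`). [cite: ArakiMoriya2003, §4.1 Def. 4.1 (2)] -/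
abbrev legOrbs (k : K) : Finset (Orb Λ₃) := orbs ((Finset.univ : Finset Λ₂).map (φ k))

/-- **The decoupled Hamiltonian** `Σ_k Γ_{φ_k}(H)`: a copy of the layer Hamiltonian `H` on every leg, no
coupling between legs. [cite: BratteliRobinsonII1997, §5.2.2] -/
def decoupledSum (H : Matrix (Finset (Orb Λ₂)) (Finset (Orb Λ₂)) ℂ) : Matrix (Finset (Orb Λ₃)) (Finset (Orb Λ₃)) ℂ :=
  ∑ k, fermionEmbed (φ k) H

variable {φ} (hφ : ∀ k j, k ≠ j → Disjoint ((Finset.univ : Finset Λ₂).map (φ k)) ((Finset.univ : Finset Λ₂).map (φ j)))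
include hφ

omit [Fintype K] [DecidableEq K] in
/-- An even operator on one leg commutes with every operator on another leg. [cite: BratteliRobinsonII1997, §5.2.2] -/
theorem commute_fermionEmbed_fermionEmbed_of_parityAut_eq {k j : K} (hkj : k ≠ j)
    {a : Matrix (Finset (Orb Λ₂)) (Finset (Orb Λ₂)) ℂ} (ha : parityAut a = a) (b : Matrix (Finset (Orb Λ₂)) (Finset (Orb Λ₂)) ℂ) :
    Commute (fermionEmbed (φ k) a) (fermionEmbed (φ j) b) :=
  commute_of_mem_carEvenSubalgebra
    (fermionEmbed_mem_carEvenSubalgebra _ (JordanWigner.mem_carEvenSubalgebra_univ_of_parityAut_eq ha))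
    (fermionEmbed_mem_carSubalgebra _ _) (disjoint_orbs (hφ k j hkj))

omit [Fintype K] [DecidableEq K] in
/-- The pairwise-commutation witness for `Finset.noncommProd` of leg-embedded even operators.
[cite: BratteliRobinsonII1997, §5.2.2] -/
theorem pairwise_commute_fermionEmbed {a : K → Matrix (Finset (Orb Λ₂)) (Finset (Orb Λ₂)) ℂ}
    (ha : ∀ k, parityAut (a k) = a k) (S : Finset K) :
    (S : Set K).Pairwise fun k j => Commute (fermionEmbed (φ k) (a k)) (fermionEmbed (φ j) (a j)) :=
  fun k _ j _ hkj => commute_fermionEmbed_fermionEmbed_of_parityAut_eq hφ hkj (ha k) (a j)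

omit [DecidableEq K] in
/-- **The Gibbs weight of the decoupled Hamiltonian factorises**: `e^{-β Σ_k Γ_k H} = Π_k Γ_k(e^{-βH})` for a
`Θ`-even `H` (the summands commute). [cite: BratteliRobinsonII1997, §5.2.2] -/
theorem gibbsWeight_decoupledSum {H : Matrix (Finset (Orb Λ₂)) (Finset (Orb Λ₂)) ℂ} (hH : parityAut H = H) (β : ℝ) :
    Matrix.gibbsWeight β (decoupledSum φ H) =
      Finset.univ.noncommProd (fun k => fermionEmbed (φ k) (Matrix.gibbsWeight β H))
        (pairwise_commute_fermionEmbed hφ (fun _ => parityAut_gibbsWeight hH β) _) := by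
  have hsmul : -(β : ℂ) • decoupledSum φ H = ∑ k, fermionEmbed (φ k) (-(β : ℂ) • H) := by
    rw [decoupledSum, Finset.smul_sum]
    exact Finset.sum_congr rfl fun k _ => (map_smul _ _ _).symm
  have hβH : parityAut (-(β : ℂ) • H) = -(β : ℂ) • H := by rw [map_smul, hH]
  rw [Matrix.gibbsWeight, hsmul, Matrix.exp_sum_of_commute Finset.univ (fun k => fermionEmbed (φ k) (-(β : ℂ) • H))
    (pairwise_commute_fermionEmbed hφ (fun _ => hβH) _)]
  refine Finset.noncommProd_congr rfl (fun k _ => ?_) _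
  rw [← fermionEmbed_exp, Matrix.gibbsWeight]

omit [Fintype K] in
/-- **The tracial state factorises over the legs**: `τ(Π_{k∈S} Γ_k(a_k)) = Π_{k∈S} τ(a_k)` for `Θ`-even `a_k`.
[cite: ArakiMoriya2003, §4.1 eq. (4.16)] -/
theorem normTrace_noncommProd_fermionEmbed {a : K → Matrix (Finset (Orb Λ₂)) (Finset (Orb Λ₂)) ℂ}
    (ha : ∀ k, parityAut (a k) = a k) (S : Finset K) :
    normTrace (S.noncommProd (fun k => fermionEmbed (φ k) (a k)) (pairwise_commute_fermionEmbed hφ ha S)) =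
      ∏ k ∈ S, normTrace (a k) := by
  induction S using Finset.induction_on with
  | empty => rw [Finset.noncommProd_empty, normTrace_one, Finset.prod_empty]
  | insert k S hk ih =>
    rw [Finset.noncommProd_insert_of_notMem _ _ _ _ hk, Finset.prod_insert hk,
      normTrace_mul_of_mem_carSubalgebra (fermionEmbed_mem_carSubalgebra _ _) (S₂ := S.biUnion (legOrbs φ)) ?_ ?_,
      normTrace_fermionEmbed, ih]
    · exact Finset.noncommProd_induction S _ _ (· ∈ carSubalgebra (S.biUnion (legOrbs φ)))
        (fun x y hx hy => Subalgebra.mul_mem _ hx hy) (Subalgebra.one_mem _)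
        fun j hj => carSubalgebra_mono (Finset.subset_biUnion_of_mem _ hj) (fermionEmbed_mem_carSubalgebra _ _)
    · exact (Finset.disjoint_biUnion_right _ _ _).2 fun j hj => disjoint_orbs (hφ k j fun h => hk (h ▸ hj))

/-- **`Z(Σ_k Γ_k H) = 2^{N₃} · (Z(H) / 2^{N₂})^{|K|}`** (`N` = number of orbitals): the partition function of the
decoupled system, for a `Θ`-even layer Hamiltonian. [cite: BratteliRobinsonII1997, §5.2.2] -/
theorem partitionFn_decoupledSum_eq {H : Matrix (Finset (Orb Λ₂)) (Finset (Orb Λ₂)) ℂ} (hH : parityAut H = H) (β : ℝ) :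
    Matrix.partitionFn β (decoupledSum φ H) =
      2 ^ Fintype.card (Orb Λ₃) * (Matrix.partitionFn β H / 2 ^ Fintype.card (Orb Λ₂)) ^ Fintype.card K := by
  have h := normTrace_noncommProd_fermionEmbed hφ (fun _ => parityAut_gibbsWeight hH β) Finset.univ
  rw [← gibbsWeight_decoupledSum hφ hH β, normTrace_apply, Finset.prod_const, Finset.card_univ, normTrace_apply] at h
  rw [Matrix.partitionFn, Matrix.partitionFn, ← h, mul_div_cancel₀ _ (pow_ne_zero _ two_ne_zero)]

/-- **`Z(Σ_k Γ_k H) = Z(H)^{|K|}`** when the legs TILE the big system (`N₃ = |K|·N₂` orbitals).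
[cite: BratteliRobinsonII1997, §5.2.2] -/
theorem partitionFn_decoupledSum {H : Matrix (Finset (Orb Λ₂)) (Finset (Orb Λ₂)) ℂ} (hH : parityAut H = H)
    (hcard : Fintype.card (Orb Λ₃) = Fintype.card K * Fintype.card (Orb Λ₂)) (β : ℝ) :
    Matrix.partitionFn β (decoupledSum φ H) = Matrix.partitionFn β H ^ Fintype.card K := by
  rw [partitionFn_decoupledSum_eq hφ hH, hcard, div_pow, ← pow_mul, mul_comm (Fintype.card (Orb Λ₂)) (Fintype.card K),
    mul_div_assoc', mul_div_cancel_left₀ _ (pow_ne_zero _ two_ne_zero)]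

/-! ### §2. Leg-odd words have zero weight against the decoupled Gibbs weight -/

/-- **`tr(Π_k Γ_k(a_k) · Γ_k(x) Γ_j(y)) = 0`** for `k ≠ j`, `Θ`-even `a`'s and `Θ`-ODD `x`: the weight of a word
that is odd on one leg vanishes (trace factorisation over the legs, `τ(even · odd) = 0`).
[cite: ArakiMoriya2003, §4.1 eq. (4.8) and (4.16)] -/
theorem trace_noncommProd_mul_fermionEmbed_mul_fermionEmbed_eq_zero {a : K → Matrix (Finset (Orb Λ₂)) (Finset (Orb Λ₂)) ℂ}
    (ha : ∀ k, parityAut (a k) = a k) {k j : K} (hkj : k ≠ j) {x : Matrix (Finset (Orb Λ₂)) (Finset (Orb Λ₂)) ℂ}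
    (hx : parityAut x = -x) (y : Matrix (Finset (Orb Λ₂)) (Finset (Orb Λ₂)) ℂ) :
    (Finset.univ.noncommProd (fun k => fermionEmbed (φ k) (a k)) (pairwise_commute_fermionEmbed hφ ha _) *
      (fermionEmbed (φ k) x * fermionEmbed (φ j) y)).trace = 0 := by
  have hsplit : Finset.univ.noncommProd (fun k => fermionEmbed (φ k) (a k)) (pairwise_commute_fermionEmbed hφ ha _) =
      fermionEmbed (φ k) (a k) * (Finset.univ.erase k).noncommProd (fun k => fermionEmbed (φ k) (a k))
        (pairwise_commute_fermionEmbed hφ ha _) :=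
    (Finset.mul_noncommProd_erase Finset.univ (Finset.mem_univ k) (fun k => fermionEmbed (φ k) (a k))
      (pairwise_commute_fermionEmbed hφ ha _) (pairwise_commute_fermionEmbed hφ ha _)).symm
  set P := (Finset.univ.erase k).noncommProd (fun k => fermionEmbed (φ k) (a k))
    (pairwise_commute_fermionEmbed hφ ha _) with hP
  have hPmem : P ∈ carEvenSubalgebra ((Finset.univ.erase k).biUnion (legOrbs φ)) :=
    Finset.noncommProd_induction _ _ _ (· ∈ carEvenSubalgebra ((Finset.univ.erase k).biUnion (legOrbs φ)))
      (fun u v hu hv => Subalgebra.mul_mem _ hu hv) (Subalgebra.one_mem _) fun i hi =>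
        carEvenSubalgebra_mono (Finset.subset_biUnion_of_mem _ hi)
          (fermionEmbed_mem_carEvenSubalgebra _ (JordanWigner.mem_carEvenSubalgebra_univ_of_parityAut_eq (ha i)))
  have hdisj : Disjoint (legOrbs φ k) ((Finset.univ.erase k).biUnion (legOrbs φ)) :=
    (Finset.disjoint_biUnion_right _ _ _).2 fun i hi => disjoint_orbs (hφ k i (Finset.ne_of_mem_erase hi).symm)
  have hPx : Commute P (fermionEmbed (φ k) x) :=
    commute_of_mem_carEvenSubalgebra hPmem (fermionEmbed_mem_carSubalgebra _ _) hdisj.symm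
  have hy : fermionEmbed (φ j) y ∈ carSubalgebra ((Finset.univ.erase k).biUnion (legOrbs φ)) :=
    carSubalgebra_mono (Finset.subset_biUnion_of_mem _ (Finset.mem_erase.2 ⟨hkj.symm, Finset.mem_univ j⟩))
      (fermionEmbed_mem_carSubalgebra _ _)
  have hodd : parityAut (a k * x) = -(a k * x) := by rw [map_mul, ha, hx, mul_neg]
  have hzero : normTrace (fermionEmbed (φ k) (a k * x)) = 0 := by
    rw [normTrace_fermionEmbed, normTrace_apply, ← Matrix.mul_one (a k * x),
      trace_mul_eq_zero_of_odd_of_even hodd (map_one parityAut), zero_div]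
  have key : normTrace (fermionEmbed (φ k) (a k) * P * (fermionEmbed (φ k) x * fermionEmbed (φ j) y)) = 0 := by
    calc normTrace (fermionEmbed (φ k) (a k) * P * (fermionEmbed (φ k) x * fermionEmbed (φ j) y))
        = normTrace (fermionEmbed (φ k) (a k * x) * (P * fermionEmbed (φ j) y)) := by
          rw [map_mul, Matrix.mul_assoc, ← Matrix.mul_assoc P, hPx.eq]; simp only [Matrix.mul_assoc]
      _ = normTrace (fermionEmbed (φ k) (a k * x)) * normTrace (P * fermionEmbed (φ j) y) :=
          normTrace_mul_of_mem_carSubalgebra (fermionEmbed_mem_carSubalgebra _ _)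
            (Subalgebra.mul_mem _ (carEvenSubalgebra_le_carSubalgebra _ hPmem) hy) hdisj
      _ = 0 := by rw [hzero, zero_mul]
  rw [hsplit]
  rw [normTrace_apply, div_eq_zero_iff] at key
  exact key.resolve_right (pow_ne_zero _ two_ne_zero)

/-- **Interlayer words have zero expectation in the decoupled Gibbs state**: `⟨Γ_k(x) Γ_j(y)⟩_{Σ Γ H} = 0` for
`k ≠ j` and `Θ`-odd `x` (e.g. `x = c†_{yσ}`). [cite: ArakiMoriya2003, §4.1 eq. (4.8)] -/
theorem gibbsState_decoupledSum_fermionEmbed_mul_fermionEmbed {H : Matrix (Finset (Orb Λ₂)) (Finset (Orb Λ₂)) ℂ}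
    (hH : parityAut H = H) (β : ℝ) {k j : K} (hkj : k ≠ j) {x : Matrix (Finset (Orb Λ₂)) (Finset (Orb Λ₂)) ℂ}
    (hx : parityAut x = -x) (y : Matrix (Finset (Orb Λ₂)) (Finset (Orb Λ₂)) ℂ) :
    Matrix.gibbsState β (decoupledSum φ H) (fermionEmbed (φ k) x * fermionEmbed (φ j) y) = 0 := by
  rw [Matrix.gibbsState_apply, gibbsWeight_decoupledSum hφ hH β,
    trace_noncommProd_mul_fermionEmbed_mul_fermionEmbed_eq_zero hφ (fun _ => parityAut_gibbsWeight hH β) hkj hx y, mul_zero]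

/-! ### §3. Interleg hopping -/

/-- **Hopping between the legs `k` and `j`** with amplitude `t`:
`−t Σ_{y,σ} (c†_{φ_k y,σ} c_{φ_j y,σ} + c†_{φ_j y,σ} c_{φ_k y,σ})` (vertical / interlayer hopping of a layered
crystal, rung hopping of coupled subsystems). [cite: PavariniEtAl2001, eq. (1)] -/
def interlegHopping (φ : K → (Λ₂ ↪ Λ₃)) (k j : K) (t : ℝ) : Matrix (Finset (Orb Λ₃)) (Finset (Orb Λ₃)) ℂ :=
  -(t : ℂ) • ∑ y : Λ₂, ∑ σ : Fin 2,
    (fermionEmbed (φ k) (creation (orb y σ)) * fermionEmbed (φ j) (annihilation (orb y σ)) +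
      fermionEmbed (φ j) (creation (orb y σ)) * fermionEmbed (φ k) (annihilation (orb y σ)))

omit [Fintype K] [DecidableEq K] hφ in
/-- The interleg hopping is Hermitian. [cite: PavariniEtAl2001, eq. (1)] -/
theorem isHermitian_interlegHopping (k j : K) (t : ℝ) : (interlegHopping φ k j t).IsHermitian := by
  have hterm : ∀ (y : Λ₂) (σ : Fin 2),
      (fermionEmbed (φ k) (creation (orb y σ)) * fermionEmbed (φ j) (annihilation (orb y σ)) +
        fermionEmbed (φ j) (creation (orb y σ)) * fermionEmbed (φ k) (annihilation (orb y σ)))ᴴ =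
      fermionEmbed (φ k) (creation (orb y σ)) * fermionEmbed (φ j) (annihilation (orb y σ)) +
        fermionEmbed (φ j) (creation (orb y σ)) * fermionEmbed (φ k) (annihilation (orb y σ)) := by
    intro y σ
    rw [Matrix.conjTranspose_add, Matrix.conjTranspose_mul, Matrix.conjTranspose_mul, ← fermionEmbed_conjTranspose,
      ← fermionEmbed_conjTranspose, ← fermionEmbed_conjTranspose, ← fermionEmbed_conjTranspose, annihilation_conjTranspose,
      creation, Matrix.conjTranspose_conjTranspose, add_comm]
  unfold Matrix.IsHermitian interlegHopping
  rw [Matrix.conjTranspose_smul, Matrix.conjTranspose_sum]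
  simp only [Matrix.conjTranspose_sum, hterm, Complex.star_def, map_neg, Complex.conj_ofReal]

/-- **The interleg hopping has zero expectation in the decoupled Gibbs state** (`k ≠ j`).
[cite: ArakiMoriya2003, §4.1 eq. (4.8)] -/
theorem gibbsState_decoupledSum_interlegHopping {H : Matrix (Finset (Orb Λ₂)) (Finset (Orb Λ₂)) ℂ}
    (hH : parityAut H = H) (β : ℝ) {k j : K} (hkj : k ≠ j) (t : ℝ) :
    Matrix.gibbsState β (decoupledSum φ H) (interlegHopping φ k j t) = 0 := by
  rw [interlegHopping, map_smul, map_sum]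
  refine smul_eq_zero_of_right _ (Finset.sum_eq_zero fun y _ => ?_)
  rw [map_sum]
  refine Finset.sum_eq_zero fun σ _ => ?_
  rw [map_add, gibbsState_decoupledSum_fermionEmbed_mul_fermionEmbed hφ hH β hkj (parityAut_creation _),
    gibbsState_decoupledSum_fermionEmbed_mul_fermionEmbed hφ hH β (Ne.symm hkj) (parityAut_creation _), add_zero]

omit [Fintype K] [DecidableEq K] hφ in
/-- **`‖interleg hopping‖ ≤ 4|t|·|Λ₂|`** (each of the `2|Λ₂|` spin-orbital rungs carries two words of norm `≤ 1`).
[cite: BratteliRobinsonI1987, Prop. 2.3.11] -/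
theorem norm_interlegHopping_le (k j : K) (t : ℝ) :
    ‖interlegHopping φ k j t‖ ≤ 4 * |t| * Fintype.card Λ₂ := by
  have hword : ∀ (k j : K) (y : Λ₂) (σ : Fin 2),
      ‖fermionEmbed (φ k) (creation (orb y σ)) * fermionEmbed (φ j) (annihilation (orb y σ))‖ ≤ 1 := by
    intro k j y σ
    rw [fermionEmbed_creation, fermionEmbed_annihilation]
    refine (Matrix.l2_opNorm_mul _ _).trans ?_
    have h1 := norm_creation_le_one (ι := Orb Λ₃) (orb (φ k y) σ)
    have h2 := norm_annihilation_le_one (ι := Orb Λ₃) (orb (φ j y) σ)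
    nlinarith [norm_nonneg (creation (orb (φ k y) σ) : Matrix (Finset (Orb Λ₃)) (Finset (Orb Λ₃)) ℂ)]
  have hS : ‖∑ y : Λ₂, ∑ σ : Fin 2, (fermionEmbed (φ k) (creation (orb y σ)) * fermionEmbed (φ j) (annihilation (orb y σ)) +
        fermionEmbed (φ j) (creation (orb y σ)) * fermionEmbed (φ k) (annihilation (orb y σ)))‖ ≤ 4 * Fintype.card Λ₂ :=
    calc ‖∑ y : Λ₂, ∑ σ : Fin 2, (fermionEmbed (φ k) (creation (orb y σ)) * fermionEmbed (φ j) (annihilation (orb y σ)) +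
          fermionEmbed (φ j) (creation (orb y σ)) * fermionEmbed (φ k) (annihilation (orb y σ)))‖
        ≤ ∑ y : Λ₂, ∑ σ : Fin 2, ‖fermionEmbed (φ k) (creation (orb y σ)) * fermionEmbed (φ j) (annihilation (orb y σ)) +
          fermionEmbed (φ j) (creation (orb y σ)) * fermionEmbed (φ k) (annihilation (orb y σ))‖ :=
          (norm_sum_le _ _).trans (Finset.sum_le_sum fun y _ => norm_sum_le _ _)
      _ ≤ ∑ _y : Λ₂, ∑ _σ : Fin 2, (2 : ℝ) := Finset.sum_le_sum fun y _ => Finset.sum_le_sum fun σ _ =>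
          (norm_add_le _ _).trans (by linarith [hword k j y σ, hword j k y σ])
      _ = 4 * Fintype.card Λ₂ := by
          rw [Finset.sum_const, Finset.card_univ, Finset.sum_const, Finset.card_univ, Fintype.card_fin]
          simp only [nsmul_eq_mul]
          ring
  rw [interlegHopping, norm_smul, norm_neg, Complex.norm_real, Real.norm_eq_abs]
  calc |t| * _ ≤ |t| * (4 * Fintype.card Λ₂) := mul_le_mul_of_nonneg_left hS (abs_nonneg t)
    _ = 4 * |t| * Fintype.card Λ₂ := by ring

end Decoupled

/-! ### §4. Two-sided bounds on `log Z` of the coupled system -/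

section LogPartition

/-- **Peierls–Bogoliubov two-sided bound with a centred perturbation**: if `⟨W⟩_{β,H} = 0` then
`log Z_β(H) ≤ log Z_β(H + W) ≤ log Z_β(H) + |β|·‖W‖` (lower: Bogoliubov's tangent inequality; upper: the
other half of the bracket and `|⟨W⟩| ≤ ‖W‖`). [cite: Lieb1973, §V eqs. (5.2)–(5.4)] -/
theorem log_partitionFn_add_mem_Icc_of_gibbsState_eq_zero {n : Type*} [Fintype n] [DecidableEq n] [Nonempty n]
    {H W : Matrix n n ℂ} (hH : H.IsHermitian) (hW : W.IsHermitian) (β : ℝ) (h0 : Matrix.gibbsState β H W = 0) :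
    Real.log (Matrix.partitionFn β (H + W)).re ∈
      Set.Icc (Real.log (Matrix.partitionFn β H).re) (Real.log (Matrix.partitionFn β H).re + |β| * ‖W‖) := by
  have h := log_partitionFn_sub_mem_Icc hH hW β
  rw [h0, Complex.zero_re, mul_zero] at h
  have hb : |β * (Matrix.gibbsState β (H + W) W).re| ≤ |β| * ‖W‖ := by
    rw [abs_mul]; exact mul_le_mul_of_nonneg_left (abs_re_gibbsState_le (hH.add hW) β W) (abs_nonneg β)
  have hb' := (abs_le.1 hb).1
  exact ⟨by linarith [h.2], by linarith [h.1]⟩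

variable {Λ₂ Λ₃ : Type*} [LinearOrder Λ₂] [Fintype Λ₂] [LinearOrder Λ₃] [Fintype Λ₃]
  {K : Type*} [Fintype K] [DecidableEq K] {φ : K → (Λ₂ ↪ Λ₃)}
  (hφ : ∀ k j, k ≠ j → Disjoint ((Finset.univ : Finset Λ₂).map (φ k)) ((Finset.univ : Finset Λ₂).map (φ j)))
include hφ

omit [DecidableEq K] hφ in
/-- The decoupled Hamiltonian of a Hermitian layer Hamiltonian is Hermitian. [cite: BratteliRobinsonII1997, §5.2.2] -/
theorem isHermitian_decoupledSum {H : Matrix (Finset (Orb Λ₂)) (Finset (Orb Λ₂)) ℂ} (hH : H.IsHermitian) :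
    (decoupledSum φ H).IsHermitian := by
  unfold Matrix.IsHermitian decoupledSum
  rw [Matrix.conjTranspose_sum]
  exact Finset.sum_congr rfl fun k _ => by rw [← fermionEmbed_conjTranspose, hH.eq]

/-- `log Z` of the decoupled system is `|K|` times `log Z` of one layer (tiling legs).
[cite: BratteliRobinsonII1997, §5.2.2] -/
theorem log_partitionFn_decoupledSum {H : Matrix (Finset (Orb Λ₂)) (Finset (Orb Λ₂)) ℂ} (hH : H.IsHermitian)
    (hHe : parityAut H = H) (hcard : Fintype.card (Orb Λ₃) = Fintype.card K * Fintype.card (Orb Λ₂)) (β : ℝ) :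
    Real.log (Matrix.partitionFn β (decoupledSum φ H)).re = Fintype.card K * Real.log (Matrix.partitionFn β H).re := by
  rw [partitionFn_decoupledSum hφ hHe hcard]
  conv_lhs => rw [partitionFn_eq_re hH β, ← Complex.ofReal_pow, Complex.ofReal_re]
  rw [Real.log_pow]

/-- **COUPLED LEGS AT `T > 0`**: for a Hermitian `Θ`-even layer Hamiltonian `H` on tiling legs and any pattern of
interleg hoppings (pairs `kp p ≠ jp p`, amplitudes `tz p`),
`|K| log Z(H) ≤ log Z(Σ_k Γ_k H + Σ_p W_p) ≤ |K| log Z(H) + 4|β|·|Λ₂|·Σ_p |tz p|` — the coupled free energy is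
BELOW the decoupled one (Bogoliubov: the hoppings have zero mean in the decoupled Gibbs state) by at most the norm
of the coupling. [cite: Lieb1973, §V eqs. (5.2)–(5.4)] -/
theorem log_partitionFn_decoupledSum_add_interleg_mem_Icc {H : Matrix (Finset (Orb Λ₂)) (Finset (Orb Λ₂)) ℂ}
    (hH : H.IsHermitian) (hHe : parityAut H = H) (hcard : Fintype.card (Orb Λ₃) = Fintype.card K * Fintype.card (Orb Λ₂))
    {P : Type*} [Fintype P] (kp jp : P → K) (hne : ∀ p, kp p ≠ jp p) (tz : P → ℝ) (β : ℝ) :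
    Real.log (Matrix.partitionFn β (decoupledSum φ H + ∑ p, interlegHopping φ (kp p) (jp p) (tz p))).re ∈
      Set.Icc (Fintype.card K * Real.log (Matrix.partitionFn β H).re)
        (Fintype.card K * Real.log (Matrix.partitionFn β H).re + |β| * (4 * Fintype.card Λ₂ * ∑ p, |tz p|)) := by
  have hW : (∑ p, interlegHopping φ (kp p) (jp p) (tz p)).IsHermitian := by
    unfold Matrix.IsHermitian
    rw [Matrix.conjTranspose_sum]
    exact Finset.sum_congr rfl fun p _ => (isHermitian_interlegHopping (kp p) (jp p) (tz p)).eq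
  have h0 : Matrix.gibbsState β (decoupledSum φ H) (∑ p, interlegHopping φ (kp p) (jp p) (tz p)) = 0 := by
    rw [map_sum]
    exact Finset.sum_eq_zero fun p _ => gibbsState_decoupledSum_interlegHopping hφ hHe β (hne p) (tz p)
  have h := log_partitionFn_add_mem_Icc_of_gibbsState_eq_zero (isHermitian_decoupledSum hH) hW β h0
  rw [log_partitionFn_decoupledSum hφ hH hHe hcard] at h
  have hnorm : ‖∑ p, interlegHopping φ (kp p) (jp p) (tz p)‖ ≤ 4 * Fintype.card Λ₂ * ∑ p, |tz p| := by
    refine (norm_sum_le _ _).trans ?_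
    rw [Finset.mul_sum]
    refine Finset.sum_le_sum fun p _ => (norm_interlegHopping_le (kp p) (jp p) (tz p)).trans (le_of_eq (by ring))
  exact ⟨h.1, h.2.trans (by nlinarith [abs_nonneg β])⟩

end LogPartition

/-! ### §5. The layered `t–t'` Hubbard torus: `(ℤ/Lℤ)³` built from `L` copies of the `(ℤ/Lℤ)²` torus -/

section Torus

variable (L : ℕ)

/-- **The layer legs of the three-dimensional torus**: `y ↦ (k, y₁, y₂)` from `(ℤ/Lℤ)²` into `(ℤ/Lℤ)³`.
[cite: ArakiMoriya2003, §4.1] -/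
def torusLayerLeg (k : Fin L) : FermionTorus 2 L ↪ FermionTorus 3 L :=
  ⟨fun y => toLex (Fin.cons k (ofLex y)), fun y y' h => by
    have h' := congrArg (fun z : FermionTorus 3 L => Fin.tail (ofLex z)) h
    simpa using h'⟩

/-- Unfolding a layer leg. [cite: ArakiMoriya2003, §4.1] -/
theorem torusLayerLeg_apply (k : Fin L) (y : FermionTorus 2 L) : torusLayerLeg L k y = toLex (Fin.cons k (ofLex y)) := rfl

/-- Different layers are disjoint. [cite: ArakiMoriya2003, §4.1] -/
theorem disjoint_torusLayerLeg (k j : Fin L) (hkj : k ≠ j) :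
    Disjoint ((Finset.univ : Finset (FermionTorus 2 L)).map (torusLayerLeg L k))
      ((Finset.univ : Finset (FermionTorus 2 L)).map (torusLayerLeg L j)) := by
  refine Finset.disjoint_left.2 fun x hx hx' => hkj ?_
  obtain ⟨y, -, rfl⟩ := Finset.mem_map.1 hx
  obtain ⟨y', -, h⟩ := Finset.mem_map.1 hx'
  have := congrArg (fun z : FermionTorus 3 L => (ofLex z) 0) h
  simpa [torusLayerLeg_apply] using this.symm

/-- Orbital count: the three-dimensional torus has `L` times the orbitals of a layer.
[cite: ArakiMoriya2003, §4.1] -/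
theorem card_orb_fermionTorus_three :
    Fintype.card (Orb (FermionTorus 3 L)) = Fintype.card (Fin L) * Fintype.card (Orb (FermionTorus 2 L)) := by
  simp only [Orb, FermionTorus, Fintype.card_lex, Fintype.card_prod, Fintype.card_fin, Fintype.card_fun]
  ring

/-- **The decoupled layers of the three-dimensional torus**: the `t–t'–U` model (grand canonical, chemical
potential `μ`) in every layer of `(ℤ/Lℤ)³`, no interlayer bond. [cite: PavariniEtAl2001, eq. (1)] -/
def decoupledHubbardTorus (t t' U μ : ℝ) : Matrix (Finset (Orb (FermionTorus 3 L))) (Finset (Orb (FermionTorus 3 L))) ℂ :=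
  decoupledSum (torusLayerLeg L) (hubbardTorusTT' L t t' U - (μ : ℂ) • totalNumber)

/-- **An interlayer hopping pattern on the three-dimensional torus**: rungs between the layers `kp p` and `jp p`
with amplitudes `tz p`. [cite: PavariniEtAl2001, eq. (1)] -/
def torusInterlayerHopping {P : Type*} [Fintype P] (kp jp : P → Fin L) (tz : P → ℝ) :
    Matrix (Finset (Orb (FermionTorus 3 L))) (Finset (Orb (FermionTorus 3 L))) ℂ :=
  ∑ p, interlegHopping (torusLayerLeg L) (kp p) (jp p) (tz p)

/-- **The layered `t–t'` Hubbard torus** `Σ_k Γ_k(H^{tt'}_L − μN_L) + Σ_p W_p`: the `t–t'–U` model (grand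
canonical, chemical potential `μ`) in every layer of `(ℤ/Lℤ)³` plus any pattern of interlayer hoppings.
[cite: PavariniEtAl2001, eq. (1)] -/
def layeredHubbardTorus (t t' U μ : ℝ) {P : Type*} [Fintype P] (kp jp : P → Fin L) (tz : P → ℝ) :
    Matrix (Finset (Orb (FermionTorus 3 L))) (Finset (Orb (FermionTorus 3 L))) ℂ :=
  decoupledHubbardTorus L t t' U μ + torusInterlayerHopping L kp jp tz

/-- **2D TORUS `log Z` BOUNDS ARE 3D LAYERED-TORUS BOUNDS**: for every `β`, every `L`, every interlayer pattern,
`L·log Z_β(H^{tt'}_L − μN) ≤ log Z_β(layered torus) ≤ L·log Z_β(H^{tt'}_L − μN) + 4|β| L² Σ_p |tz p|`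
(per site: the grand potential of the layered crystal is that of one layer, lowered by at most `4Σ_p|tz p|/L`;
for the uniform vertical stacking `Σ_p |tz p| = L|t_z|`: at most `4|t_z|` per site). [cite: Lieb1973, §V eqs. (5.2)–(5.4)] -/
theorem log_partitionFn_layeredHubbardTorus_mem_Icc (t t' U μ : ℝ) {P : Type*} [Fintype P] (kp jp : P → Fin L)
    (hne : ∀ p, kp p ≠ jp p) (tz : P → ℝ) (β : ℝ) :
    Real.log (Matrix.partitionFn β (layeredHubbardTorus L t t' U μ kp jp tz)).re ∈
      Set.Icc (L * Real.log (Matrix.partitionFn β (hubbardTorusTT' L t t' U - (μ : ℂ) • totalNumber)).re)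
        (L * Real.log (Matrix.partitionFn β (hubbardTorusTT' L t t' U - (μ : ℂ) • totalNumber)).re +
          |β| * (4 * (L ^ 2 : ℕ) * ∑ p, |tz p|)) := by
  have h := log_partitionFn_decoupledSum_add_interleg_mem_Icc (disjoint_torusLayerLeg L)
    (isHermitian_hubbardTorusTT'_sub_mu (L := L) t t' U μ) (parityAut_hubbardTorusTT'_sub_mu (L := L) t t' U μ)
    (card_orb_fermionTorus_three L) kp jp hne tz β
  have hcard2 : Fintype.card (FermionTorus 2 L) = L ^ 2 := by
    simp only [FermionTorus, Fintype.card_lex, Fintype.card_fun, Fintype.card_fin]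
  have e1 : (Fintype.card (Fin L) : ℝ) = L := by rw [Fintype.card_fin]
  have e2 : (Fintype.card (FermionTorus 2 L) : ℝ) = ((L ^ 2 : ℕ) : ℝ) := by rw [hcard2]
  rw [e1, e2] at h
  unfold layeredHubbardTorus decoupledHubbardTorus torusInterlayerHopping
  convert h using 9

/-- **Per-site form** (`β > 0`): the grand potential per site of the layered torus,
`−(β L³)⁻¹ log Z_β(layered)`, lies in `[f₂ − 4Σ_p|tz p|/L, f₂]` with `f₂ = −(β L²)⁻¹ log Z_β(H^{tt'}_L − μN)` the
grand potential per site of one layer. [cite: Lieb1973, §V eqs. (5.2)–(5.4)] -/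
theorem grandPotentialPerSite_layeredHubbardTorus_mem_Icc (hL : 0 < L) (t t' U μ : ℝ) {P : Type*} [Fintype P]
    (kp jp : P → Fin L) (hne : ∀ p, kp p ≠ jp p) (tz : P → ℝ) {β : ℝ} (hβ : 0 < β) :
    -(Real.log (Matrix.partitionFn β (layeredHubbardTorus L t t' U μ kp jp tz)).re) / (β * (L : ℝ) ^ 3) ∈
      Set.Icc (-(Real.log (Matrix.partitionFn β (hubbardTorusTT' L t t' U - (μ : ℂ) • totalNumber)).re) / (β * (L : ℝ) ^ 2)
          - 4 * (∑ p, |tz p|) / L)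
        (-(Real.log (Matrix.partitionFn β (hubbardTorusTT' L t t' U - (μ : ℂ) • totalNumber)).re) / (β * (L : ℝ) ^ 2)) := by
  have h := log_partitionFn_layeredHubbardTorus_mem_Icc L t t' U μ kp jp hne tz β
  rw [abs_of_pos hβ, Nat.cast_pow] at h
  set x := Real.log (Matrix.partitionFn β (layeredHubbardTorus L t t' U μ kp jp tz)).re
  set a := Real.log (Matrix.partitionFn β (hubbardTorusTT' L t t' U - (μ : ℂ) • totalNumber)).re
  set S := ∑ p, |tz p|
  have hLr : (0 : ℝ) < L := Nat.cast_pos.2 hL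
  have hβL3 : 0 < β * (L : ℝ) ^ 3 := by positivity
  have hβL2 : 0 < β * (L : ℝ) ^ 2 := by positivity
  constructor
  · -- upper bound on `x` gives the lower bound on `−x/(βL³)`
    have h2 : x ≤ L * a + β * (4 * (L : ℝ) ^ 2 * S) := h.2
    have key : -x / (β * (L : ℝ) ^ 3) - (-a / (β * (L : ℝ) ^ 2) - 4 * S / L) =
        (L * a + β * (4 * (L : ℝ) ^ 2 * S) - x) / (β * (L : ℝ) ^ 3) := by
      field_simp
      ring
    have : 0 ≤ -x / (β * (L : ℝ) ^ 3) - (-a / (β * (L : ℝ) ^ 2) - 4 * S / L) := by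
      rw [key]; exact div_nonneg (by linarith) hβL3.le
    linarith
  · have h1 : L * a ≤ x := h.1
    have key : -a / (β * (L : ℝ) ^ 2) - -x / (β * (L : ℝ) ^ 3) = (x - L * a) / (β * (L : ℝ) ^ 3) := by
      field_simp
      ring
    have : 0 ≤ -a / (β * (L : ℝ) ^ 2) - -x / (β * (L : ℝ) ^ 3) := by
      rw [key]; exact div_nonneg (by linarith) hβL3.le
    linarith

end Torus

/-! ### §6 (append). The sharp rung norm `2|t|·|Λ₂|` and the sharpened bounds -/

section Sharp

variable {Λ₂ Λ₃ : Type*} [LinearOrder Λ₂] [Fintype Λ₂] [LinearOrder Λ₃] [Fintype Λ₃]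
  {K : Type*} [Fintype K] [DecidableEq K] {φ : K → (Λ₂ ↪ Λ₃)}
  (hφ : ∀ k j, k ≠ j → Disjoint ((Finset.univ : Finset Λ₂).map (φ k)) ((Finset.univ : Finset Λ₂).map (φ j)))
include hφ

omit [Fintype K] [DecidableEq K] in
/-- **`‖interleg hopping‖ ≤ 2|t|·|Λ₂|`** for distinct legs: each rung `−t Σ_σ (c†_{φ_k y,σ} c_{φ_j y,σ} + h.c.)` is a
two-spin hopping bond between distinct orbitals, of norm `≤ 2|t|` (Koma–Tasaki; the tree's `norm_hoppingTerm_le_two_mul`).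
[cite: KomaTasakiPRL1992, eq. (11) remark] -/
theorem norm_interlegHopping_le_two_mul {k j : K} (hkj : k ≠ j) (t : ℝ) :
    ‖interlegHopping φ k j t‖ ≤ 2 * |t| * Fintype.card Λ₂ := by
  have hne : ∀ (y : Λ₂) (σ : Fin 2), (orb (φ k y) σ : Orb Λ₃) ≠ orb (φ j y) σ := by
    intro y σ h
    have hx : φ k y = φ j y := by simpa [orb] using congrArg (fun i : Orb Λ₃ => (ofLex i).1) h
    exact Finset.disjoint_left.1 (hφ k j hkj) (Finset.mem_map_of_mem _ (Finset.mem_univ y))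
      (by rw [hx]; exact Finset.mem_map_of_mem _ (Finset.mem_univ y))
  have hrung : ∀ y : Λ₂, ‖-(t : ℂ) • ∑ σ : Fin 2,
      (fermionEmbed (φ k) (creation (orb y σ)) * fermionEmbed (φ j) (annihilation (orb y σ)) +
        fermionEmbed (φ j) (creation (orb y σ)) * fermionEmbed (φ k) (annihilation (orb y σ)))‖ ≤ 2 * |t| := by
    intro y
    have h := norm_hoppingTerm_le_two_mul t (fun σ => orb (φ k y) σ) (fun σ => orb (φ j y) σ) (hne y)
    simp only [creation, fermionEmbed_conjTranspose, fermionEmbed_annihilation]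
    convert h using 4
  rw [interlegHopping, Finset.smul_sum]
  calc ‖∑ y : Λ₂, -(t : ℂ) • ∑ σ : Fin 2,
        (fermionEmbed (φ k) (creation (orb y σ)) * fermionEmbed (φ j) (annihilation (orb y σ)) +
          fermionEmbed (φ j) (creation (orb y σ)) * fermionEmbed (φ k) (annihilation (orb y σ)))‖
      ≤ ∑ y : Λ₂, 2 * |t| := (norm_sum_le _ _).trans (Finset.sum_le_sum fun y _ => hrung y)
    _ = 2 * |t| * Fintype.card Λ₂ := by rw [Finset.sum_const, Finset.card_univ, nsmul_eq_mul]; ring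

/-- **COUPLED LEGS AT `T > 0`, sharp constant**:
`|K| log Z(H) ≤ log Z(Σ_k Γ_k H + Σ_p W_p) ≤ |K| log Z(H) + 2|β|·|Λ₂|·Σ_p |tz p|`. [cite: Lieb1973, §V eqs. (5.2)–(5.4)] -/
theorem log_partitionFn_decoupledSum_add_interleg_mem_Icc_sharp {H : Matrix (Finset (Orb Λ₂)) (Finset (Orb Λ₂)) ℂ}
    (hH : H.IsHermitian) (hHe : parityAut H = H) (hcard : Fintype.card (Orb Λ₃) = Fintype.card K * Fintype.card (Orb Λ₂))
    {P : Type*} [Fintype P] (kp jp : P → K) (hne : ∀ p, kp p ≠ jp p) (tz : P → ℝ) (β : ℝ) :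
    Real.log (Matrix.partitionFn β (decoupledSum φ H + ∑ p, interlegHopping φ (kp p) (jp p) (tz p))).re ∈
      Set.Icc (Fintype.card K * Real.log (Matrix.partitionFn β H).re)
        (Fintype.card K * Real.log (Matrix.partitionFn β H).re + |β| * (2 * Fintype.card Λ₂ * ∑ p, |tz p|)) := by
  have hW : (∑ p, interlegHopping φ (kp p) (jp p) (tz p)).IsHermitian := by
    unfold Matrix.IsHermitian
    rw [Matrix.conjTranspose_sum]
    exact Finset.sum_congr rfl fun p _ => (isHermitian_interlegHopping (kp p) (jp p) (tz p)).eq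
  have h0 : Matrix.gibbsState β (decoupledSum φ H) (∑ p, interlegHopping φ (kp p) (jp p) (tz p)) = 0 := by
    rw [map_sum]
    exact Finset.sum_eq_zero fun p _ => gibbsState_decoupledSum_interlegHopping hφ hHe β (hne p) (tz p)
  have h := log_partitionFn_add_mem_Icc_of_gibbsState_eq_zero (isHermitian_decoupledSum hH) hW β h0
  rw [log_partitionFn_decoupledSum hφ hH hHe hcard] at h
  have hnorm : ‖∑ p, interlegHopping φ (kp p) (jp p) (tz p)‖ ≤ 2 * Fintype.card Λ₂ * ∑ p, |tz p| := by
    refine (norm_sum_le _ _).trans ?_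
    rw [Finset.mul_sum]
    refine Finset.sum_le_sum fun p _ => (norm_interlegHopping_le_two_mul hφ (hne p) (tz p)).trans (le_of_eq (by ring))
  exact ⟨h.1, h.2.trans (by nlinarith [abs_nonneg β])⟩

end Sharp

section TorusSharp

variable (L : ℕ)

/-- **2D TORUS `log Z` BOUNDS ARE 3D LAYERED-TORUS BOUNDS, sharp constant**:
`L·log Z₂ ≤ log Z_β(layered torus) ≤ L·log Z₂ + 2|β| L² Σ_p |tz p|`. [cite: Lieb1973, §V eqs. (5.2)–(5.4)] -/
theorem log_partitionFn_layeredHubbardTorus_mem_Icc_sharp (t t' U μ : ℝ) {P : Type*} [Fintype P] (kp jp : P → Fin L)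
    (hne : ∀ p, kp p ≠ jp p) (tz : P → ℝ) (β : ℝ) :
    Real.log (Matrix.partitionFn β (layeredHubbardTorus L t t' U μ kp jp tz)).re ∈
      Set.Icc (L * Real.log (Matrix.partitionFn β (hubbardTorusTT' L t t' U - (μ : ℂ) • totalNumber)).re)
        (L * Real.log (Matrix.partitionFn β (hubbardTorusTT' L t t' U - (μ : ℂ) • totalNumber)).re +
          |β| * (2 * (L ^ 2 : ℕ) * ∑ p, |tz p|)) := by
  have h := log_partitionFn_decoupledSum_add_interleg_mem_Icc_sharp (disjoint_torusLayerLeg L)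
    (isHermitian_hubbardTorusTT'_sub_mu (L := L) t t' U μ) (parityAut_hubbardTorusTT'_sub_mu (L := L) t t' U μ)
    (card_orb_fermionTorus_three L) kp jp hne tz β
  have hcard2 : Fintype.card (FermionTorus 2 L) = L ^ 2 := by
    simp only [FermionTorus, Fintype.card_lex, Fintype.card_fun, Fintype.card_fin]
  have e1 : (Fintype.card (Fin L) : ℝ) = L := by rw [Fintype.card_fin]
  have e2 : (Fintype.card (FermionTorus 2 L) : ℝ) = ((L ^ 2 : ℕ) : ℝ) := by rw [hcard2]
  rw [e1, e2] at h
  unfold layeredHubbardTorus decoupledHubbardTorus torusInterlayerHopping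
  convert h using 9

/-- **Per-site form, sharp constant** (`β > 0`): grand potential per site of the layered torus
`∈ [f₂ − 2Σ_p|tz p|/L, f₂]` (uniform vertical stacking, `Σ_p|tz p| = L|t_z|`: at most `2|t_z|` per site — the same
allowance as at `T = 0`). [cite: Lieb1973, §V eqs. (5.2)–(5.4)] -/
theorem grandPotentialPerSite_layeredHubbardTorus_mem_Icc_sharp (hL : 0 < L) (t t' U μ : ℝ) {P : Type*} [Fintype P]
    (kp jp : P → Fin L) (hne : ∀ p, kp p ≠ jp p) (tz : P → ℝ) {β : ℝ} (hβ : 0 < β) :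
    -(Real.log (Matrix.partitionFn β (layeredHubbardTorus L t t' U μ kp jp tz)).re) / (β * (L : ℝ) ^ 3) ∈
      Set.Icc (-(Real.log (Matrix.partitionFn β (hubbardTorusTT' L t t' U - (μ : ℂ) • totalNumber)).re) / (β * (L : ℝ) ^ 2)
          - 2 * (∑ p, |tz p|) / L)
        (-(Real.log (Matrix.partitionFn β (hubbardTorusTT' L t t' U - (μ : ℂ) • totalNumber)).re) / (β * (L : ℝ) ^ 2)) := by
  have h := log_partitionFn_layeredHubbardTorus_mem_Icc_sharp L t t' U μ kp jp hne tz β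
  rw [abs_of_pos hβ, Nat.cast_pow] at h
  set x := Real.log (Matrix.partitionFn β (layeredHubbardTorus L t t' U μ kp jp tz)).re
  set a := Real.log (Matrix.partitionFn β (hubbardTorusTT' L t t' U - (μ : ℂ) • totalNumber)).re
  set S := ∑ p, |tz p|
  have hLr : (0 : ℝ) < L := Nat.cast_pos.2 hL
  have hβL3 : 0 < β * (L : ℝ) ^ 3 := by positivity
  constructor
  · have h2 : x ≤ L * a + β * (2 * (L : ℝ) ^ 2 * S) := h.2
    have key : -x / (β * (L : ℝ) ^ 3) - (-a / (β * (L : ℝ) ^ 2) - 2 * S / L) =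
        (L * a + β * (2 * (L : ℝ) ^ 2 * S) - x) / (β * (L : ℝ) ^ 3) := by
      field_simp
      ring
    have : 0 ≤ -x / (β * (L : ℝ) ^ 3) - (-a / (β * (L : ℝ) ^ 2) - 2 * S / L) := by
      rw [key]; exact div_nonneg (by linarith) hβL3.le
    linarith
  · have h1 : L * a ≤ x := h.1
    have key : -a / (β * (L : ℝ) ^ 2) - -x / (β * (L : ℝ) ^ 3) = (x - L * a) / (β * (L : ℝ) ^ 3) := by
      field_simp
      ring
    have : 0 ≤ -a / (β * (L : ℝ) ^ 2) - -x / (β * (L : ℝ) ^ 3) := by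
      rw [key]; exact div_nonneg (by linarith) hβL3.le
    linarith

end TorusSharp

end Literature.MathematicalPhysics.QuantumLattice
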